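import Summits.KontsevichZagierPeriods.KontsevichZagierPeriods.Theorems.RootDecompRelativeModAbsoluteEvenCircleP4

/-! # `RootDecompRelativeModAbsoluteEvenCircleP5` — part 5/10 of the mechanical ≤400-line split of `evB_src3.lean` (sha256 9b9fc462830f2800…)
Source: decomp-kz lens-3 g14 EvenCircle.lean FINAL @ba0f3b57 §K0–§K12 (land/EvenCircleB @954ab641, lint-fixed, §K12 re-pointed at the landed CircleSplit names; critic CLEARED g7-2 l.1388: evenCircleCellClose_holds); --supports stmt-KontsevichZagierPeriods-30572.
Split by census-1 g10 `gen/splitlean.py`: scopes re-opened with their `open`/`variable`/`set_option` context; mathematics and declaration order unchanged. -/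

noncomputable section
open Set MeasureTheory
open Literature.NumberTheory.Transcendental Literature.ModelTheory.ExponentialFields
namespace Summit.KontsevichZagierPeriods.RootDecompRelativeModAbsolute.Rung30571.RegularisedLogLayer.CylLog.Leaf.G13
namespace AngleFold

/-- `|Q_n(v)| ≤ G_n(v) + arctan v` for `v ≥ 0` (integrate `abs_qk_le`). -/
theorem abs_Qk_le (n : ℕ) {v : ℝ} (hv : 0 ≤ v) : |Qk n v| ≤ Gn n v + Real.arctan v := by
  have hQ : Qk n v = ∫ t in (0:ℝ)..v, qk n t := by
    rw [intervalIntegral.integral_eq_sub_of_hasDerivAt (fun t _ => hasDerivAt_Qk n t)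
      ((continuous_qk n).intervalIntegrable _ _), Qk_zero_right, sub_zero]
  have hc1 : Continuous fun t : ℝ => 1 / (1 + t ^ 2) := continuous_const.div (by fun_prop) fun t => by positivity
  have hat : ∫ x in (0:ℝ)..v, 1 / (1 + x ^ 2) = Real.arctan v := by
    rw [intervalIntegral.integral_eq_sub_of_hasDerivAt (fun x _ => Real.hasDerivAt_arctan x)
      (hc1.intervalIntegrable _ _), Real.arctan_zero, sub_zero]
  have hadd : ∫ x in (0:ℝ)..v, (gk n x + 1 / (1 + x ^ 2)) = Gn n v + Real.arctan v := by
    rw [intervalIntegral.integral_add ((continuous_gk n).intervalIntegrable _ _) (hc1.intervalIntegrable _ _), hat]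
    rfl
  rw [hQ, ← hadd]
  calc |∫ t in (0:ℝ)..v, qk n t| ≤ ∫ t in (0:ℝ)..v, |qk n t| :=
        intervalIntegral.abs_integral_le_integral_abs hv
    _ ≤ ∫ t in (0:ℝ)..v, (gk n t + 1 / (1 + t ^ 2)) :=
        intervalIntegral.integral_mono_on hv ((continuous_qk n).abs.intervalIntegrable _ _)
          (((continuous_gk n).add hc1).intervalIntegrable _ _) fun t _ => abs_qk_le n t

/-- In a monotone regime, `p ∈ L¹(T)` from `p·G_n(u) ∈ L¹(T)`, local integrability at the bottom and a lower bound
`G_n(u) ≥ c > 0` beyond a point `x₁`. -/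
theorem integrableOn_of_Gn_lower {T : Set (Fin 1 → ℝ)} (hT : IsSemialgebraic ℚ T) (n : ℕ) {p u : (Fin 1 → ℝ) → ℝ}
    (hp : IsSemialgebraicFunOn ℚ T p) (hint : IntegrableOn (fun x => p x * Gn n (u x)) T)
    {x₁ : Fin 1 → ℝ} {c : ℝ} (hc : 0 < c) (hcG : ∀ x ∈ T, x₁ 0 ≤ x 0 → c ≤ Gn n (u x))
    (hloc : IntegrableOn p {x | x ∈ T ∧ x 0 ≤ x₁ 0}) : IntegrableOn p T := by
  have hTm : MeasurableSet T := hT.measurableSet_holds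
  set B : Set (Fin 1 → ℝ) := T ∩ {x | x₁ 0 ≤ x 0} with hB
  have hBm : MeasurableSet B := hTm.inter (measurableSet_le measurable_const (measurable_pi_apply 0))
  have hBT : B ⊆ T := fun x hx => hx.1
  have hBint : IntegrableOn p B := by
    have h1 : IntegrableOn (fun x => p x * Gn n (u x)) B := hint.mono_set hBT
    refine Integrable.mono' (h1.norm.div_const c)
      ((KZ.aestronglyMeasurable_of_isSemialgebraicFunOn hp hTm).mono_measure (Measure.restrict_mono hBT le_rfl)) ?_
    refine (ae_restrict_iff' hBm).2 (Filter.Eventually.of_forall fun x hx => ?_)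
    have hG : c ≤ Gn n (u x) := hcG x hx.1 hx.2
    have hG0 : 0 ≤ Gn n (u x) := hc.le.trans hG
    rw [Real.norm_eq_abs, Real.norm_eq_abs, abs_mul, abs_of_nonneg hG0, le_div_iff₀ hc]
    exact mul_le_mul_of_nonneg_left hG (abs_nonneg _)
  refine (hloc.union hBint).mono_set fun x hx => ?_
  rcases le_total (x 0) (x₁ 0) with h | h
  · exact Or.inl ⟨hx, h⟩
  · exact Or.inr ⟨hx, h⟩

/-! ### §K6 The uniform per-index PACKAGE at the top end of a half-cell (all regimes: constant, decreasing — incl. WILD —,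
increasing bounded, increasing unbounded = kernel division + rule 3 in `s` + `AngleFold.edge_package` for the arctan part). -/

/-- Auxiliary step `Gn_pos` (§K6): Gn pos. [bookkeeping] -/
theorem Gn_pos (n : ℕ) {c : ℝ} (hc : 0 < c) : 0 < Gn n c := by
  refine intervalIntegral.intervalIntegral_pos_of_pos_on ((continuous_gk n).intervalIntegrable _ _) (fun t ht => ?_) hc
  simp only [gk]
  have : 0 < t := ht.1
  positivity

/-- Auxiliary step `volume_band_zero` (§K6): volume band zero. [bookkeeping] -/
theorem volume_band_zero {T : Set (Fin 1 → ℝ)} : volume (KZlog.band T (fun _ => (0:ℝ)) (fun _ => 0)) = 0 :=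
  measure_mono_null (fun _z hz => le_antisymm hz.2.2 hz.2.1) (KZ.volume_setOf_last_eq_zero (n := 1) 0)

/-- Auxiliary step `sa_signMul` (§K6): sa sign Mul. [bookkeeping] -/
theorem sa_signMul {T : Set (Fin 1 → ℝ)} (hT : IsSemialgebraic ℚ T) {p : (Fin 1 → ℝ) → ℝ} (hp : IsSemialgebraicFunOn ℚ T p)
    (n : ℕ) : IsSemialgebraicFunOn ℚ T (fun x => (-1) ^ n * p x) :=
  ((saConst_ratCast hT ((-1) ^ n)).mul_holds hp).congr fun x _ => by push_cast; rfl

/-- Auxiliary step `integrableOn_mul_arctan` (§K6): integrable On mul arctan. [bookkeeping] -/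
theorem integrableOn_mul_arctan {T : Set (Fin 1 → ℝ)} (hT : IsSemialgebraic ℚ T) {p u : (Fin 1 → ℝ) → ℝ}
    (hu : IsSemialgebraicFunOn ℚ T u) (hpi : IntegrableOn p T) (c : ℝ) :
    IntegrableOn (fun x => c * p x * Real.arctan (u x)) T := by
  have hTm : MeasurableSet T := hT.measurableSet_holds
  refine Integrable.mono' ((hpi.norm.const_mul (|c| * (Real.pi / 2))))
    (((hpi.aestronglyMeasurable.const_mul c)).mul
      (Real.continuous_arctan.comp_aestronglyMeasurable (KZ.aestronglyMeasurable_of_isSemialgebraicFunOn hu hTm))) ?_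
  refine Filter.Eventually.of_forall fun x => ?_
  rw [Real.norm_eq_abs, Real.norm_eq_abs, abs_mul, abs_mul]
  have h1 : |Real.arctan (u x)| ≤ Real.pi / 2 := (abs_le.2 ⟨(Real.neg_pi_div_two_lt_arctan _).le, (Real.arctan_lt_pi_div_two _).le⟩)
  have h2 : 0 ≤ |c| * |p x| := mul_nonneg (abs_nonneg _) (abs_nonneg _)
  calc |c| * |p x| * |Real.arctan (u x)| ≤ |c| * |p x| * (Real.pi / 2) := mul_le_mul_of_nonneg_left h1 h2
    _ = |c| * (Real.pi / 2) * |p x| := by ring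

/-- **The per-index package (PROVED, all regimes).**  For one index on an order-convex open cell `T` (top end = the base
point): a constant circle band `K = ⟦band T 0 d; p g_n⟧`, three constant arctan bands `V_k` with integer multiplicities
(non-trivial only in the unbounded increasing regime, from `AngleFold.edge_package`), a base rep `R = ⟦T; (1−ε) p Q_n(u)⟧`
(non-trivial only in that regime, `ε = 0`), and ONE Jacobian rep `W` on `Rgn T` with integrand
`ε·p(x) q_n(u ξ) u'(ξ) + wfun((−1)^n p, u)`, such that `cl A = cl K + Σ_k cl V_k + cl R − cl W`; plus the limit data at the
top end (`u → d` when `ε = 1`; `arctan u → ε·arctan d + Σ_k cv_k arctan dv_k` always) and `p ∈ L¹(T)` whenever `d > 0`. -/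
theorem edge_package_circ {T : Set (Fin 1 → ℝ)} (hT : IsSemialgebraic ℚ T) (hTo : IsOpen T) (hTc : OrdConv T)
    (hne : T.Nonempty) (n : ℕ) {p u : (Fin 1 → ℝ) → ℝ} (hp : IsSemialgebraicFunOn ℚ T p) (hu : IsSemialgebraicFunOn ℚ T u)
    (hu0 : ∀ x ∈ T, 0 ≤ u x) (hud : ∀ x ∈ T, DifferentiableAt ℝ u x)
    (hsgn : (∀ x ∈ T, du u x = 0) ∨ (∀ x ∈ T, du u x < 0) ∨ (∀ x ∈ T, 0 < du u x))
    (hone : (∀ x ∈ T, u x ≤ 1) ∨ (∀ x ∈ T, 1 ≤ u x))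
    (A : KZ.IntegralRep 2) (hAd : A.domain = KZlog.band T (fun _ => 0) u)
    (hAi : EqOn A.integrand (fun z => p (Fin.init z) * gk n (z (Fin.last 1))) A.domain)
    (hint : IntegrableOn (fun x => p x * Gn n (u x)) T)
    (hloc : ∀ x₁ ∈ T, IntegrableOn p {x | x ∈ T ∧ x 0 ≤ x₁ 0}) :
    ∃ (d ε : ℝ) (K : KZ.IntegralRep 2) (dv : Fin 3 → ℝ) (cv : Fin 3 → ℤ) (V : Fin 3 → KZ.IntegralRep 2)
      (W : KZ.IntegralRep 2) (R : KZ.IntegralRep 1),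
      0 ≤ d ∧ SaConst T d ∧ (ε = 0 ∨ ε = 1) ∧
      K.domain = KZlog.band T (fun _ => 0) (fun _ => d) ∧
      K.integrand = (fun z => p (Fin.init z) * gk n (z (Fin.last 1))) ∧
      (∀ k, 0 ≤ dv k) ∧ (∀ k, SaConst T (dv k)) ∧
      (∀ k, (V k).domain = KZlog.band T (fun _ => 0) (fun _ => dv k)) ∧
      (∀ k, EqOn (V k).integrand (fun z => (cv k : ℝ) * ((-1) ^ n * p (Fin.init z)) / (1 + z (Fin.last 1) ^ 2))
        (V k).domain) ∧
      W.domain = Rgn T ∧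
      EqOn W.integrand (fun z => ε * (p (Fin.init z) * qk n (u (bpt (z (Fin.last 1)))) * du u (bpt (z (Fin.last 1)))) +
        wfun (fun x => (-1) ^ n * p x) u z) W.domain ∧
      R.domain = T ∧ EqOn R.integrand (fun x => (1 - ε) * (p x * Qk n (u x))) T ∧
      cl A = cl K + ∑ k, cl (V k) + cl R - cl W ∧
      (ε = 1 → ∀ δ > 0, ∃ x₁ ∈ T, ∀ x ∈ T, x₁ 0 ≤ x 0 → |u x - d| < δ) ∧
      (∀ δ > 0, ∃ x₁ ∈ T, ∀ x ∈ T, x₁ 0 ≤ x 0 →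
        |Real.arctan (u x) - (ε * Real.arctan d + ∑ k, (cv k : ℝ) * Real.arctan (dv k))| < δ) ∧
      (0 < d → IntegrableOn p T) ∧ (ε = 0 → d = 0) := by
  classical
  have hTm : MeasurableSet T := IsSemialgebraic.measurableSet_holds hT
  have hRsa : IsSemialgebraic ℚ (Rgn T) := isSemialgebraic_Rgn hT
  have hRm : MeasurableSet (Rgn T) := IsSemialgebraic.measurableSet_holds hRsa
  obtain ⟨x₂, hx₂⟩ := hne
  have hp' : IsSemialgebraicFunOn ℚ T (fun x => (-1) ^ n * p x) := sa_signMul hT hp n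
  -- zero gadgets
  have h0band : IsSemialgebraic ℚ (KZlog.band T (fun _ => (0:ℝ)) (fun _ => 0)) :=
    KZlog.isSemialgebraic_band (saConst_zero hT) (saConst_zero hT)
  obtain ⟨Z, hZd, hZi⟩ := KZ.exists_zeroRep h0band
  have hZcl : cl Z = 0 := cl_eq_zero_of_eqOn_zero Z (by rw [hZi]; exact fun _ _ => rfl)
  have hZi' : EqOn Z.integrand (fun z => ((0:ℤ) : ℝ) * ((-1) ^ n * p (Fin.init z)) / (1 + z (Fin.last 1) ^ 2)) Z.domain :=
    fun z _ => by rw [hZi]; simp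
  obtain ⟨Z₁, hZ₁d, hZ₁i⟩ := KZ.exists_zeroRep hT
  have hZ₁cl : cl Z₁ = 0 := cl_eq_zero_of_eqOn_zero Z₁ (by rw [hZ₁i]; exact fun _ _ => rfl)
  have hZ₁i' : EqOn Z₁.integrand (fun x => (1 - 1) * (p x * Qk n (u x))) T := fun x _ => by rw [hZ₁i]; simp
  obtain ⟨Z₂, hZ₂d, hZ₂i⟩ := KZ.exists_zeroRep hRsa
  have hZ₂cl : cl Z₂ = 0 := cl_eq_zero_of_eqOn_zero Z₂ (by rw [hZ₂i]; exact fun _ _ => rfl)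
  -- template for the whole-kernel regimes (`ε = 1`, no `V`, no `R`)
  have whole : ∀ (d : ℝ) (K W : KZ.IntegralRep 2), 0 ≤ d → SaConst T d →
      K.domain = KZlog.band T (fun _ => 0) (fun _ => d) →
      K.integrand = (fun z => p (Fin.init z) * gk n (z (Fin.last 1))) →
      W.domain = Rgn T →
      EqOn W.integrand (fun z => 1 * (p (Fin.init z) * qk n (u (bpt (z (Fin.last 1)))) * du u (bpt (z (Fin.last 1)))) +
        wfun (fun x => (-1) ^ n * p x) u z) W.domain →
      cl A = cl K - cl W →
      (∀ δ > 0, ∃ x₁ ∈ T, ∀ x ∈ T, x₁ 0 ≤ x 0 → |u x - d| < δ) →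
      (0 < d → IntegrableOn p T) →
      ∃ (d ε : ℝ) (K : KZ.IntegralRep 2) (dv : Fin 3 → ℝ) (cv : Fin 3 → ℤ) (V : Fin 3 → KZ.IntegralRep 2)
        (W : KZ.IntegralRep 2) (R : KZ.IntegralRep 1),
        0 ≤ d ∧ SaConst T d ∧ (ε = 0 ∨ ε = 1) ∧
        K.domain = KZlog.band T (fun _ => 0) (fun _ => d) ∧
        K.integrand = (fun z => p (Fin.init z) * gk n (z (Fin.last 1))) ∧
        (∀ k, 0 ≤ dv k) ∧ (∀ k, SaConst T (dv k)) ∧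
        (∀ k, (V k).domain = KZlog.band T (fun _ => 0) (fun _ => dv k)) ∧
        (∀ k, EqOn (V k).integrand (fun z => (cv k : ℝ) * ((-1) ^ n * p (Fin.init z)) / (1 + z (Fin.last 1) ^ 2))
          (V k).domain) ∧
        W.domain = Rgn T ∧
        EqOn W.integrand (fun z => ε * (p (Fin.init z) * qk n (u (bpt (z (Fin.last 1)))) * du u (bpt (z (Fin.last 1)))) +
          wfun (fun x => (-1) ^ n * p x) u z) W.domain ∧
        R.domain = T ∧ EqOn R.integrand (fun x => (1 - ε) * (p x * Qk n (u x))) T ∧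
        cl A = cl K + ∑ k, cl (V k) + cl R - cl W ∧
        (ε = 1 → ∀ δ > 0, ∃ x₁ ∈ T, ∀ x ∈ T, x₁ 0 ≤ x 0 → |u x - d| < δ) ∧
        (∀ δ > 0, ∃ x₁ ∈ T, ∀ x ∈ T, x₁ 0 ≤ x 0 →
          |Real.arctan (u x) - (ε * Real.arctan d + ∑ k, (cv k : ℝ) * Real.arctan (dv k))| < δ) ∧
        (0 < d → IntegrableOn p T) ∧ (ε = 0 → d = 0) := by
    intro d K W hd0 hds hKd hKi hWd hWi eA happr hpL
    refine ⟨d, 1, K, ![0, 0, 0], ![0, 0, 0], ![Z, Z, Z], W, Z₁, hd0, hds, Or.inr rfl, hKd, hKi, ?_, ?_, ?_, ?_, hWd, hWi,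
      hZ₁d, hZ₁i', ?_, fun _ => happr, ?_, hpL, fun h => absurd h one_ne_zero⟩
    · intro k; fin_cases k <;> exact le_rfl
    · intro k; fin_cases k <;> exact saConst_zero hT
    · intro k; fin_cases k <;> exact hZd
    · intro k; fin_cases k <;> exact hZi'
    · rw [Fin.sum_univ_three]
      show cl A = cl K + (cl Z + cl Z + cl Z) + cl Z₁ - cl W
      rw [hZcl, hZ₁cl, eA]; abel
    · intro δ hδ
      obtain ⟨η, hη, hcont⟩ := Metric.continuousAt_iff.1 (Real.continuous_arctan.continuousAt (x := d)) δ hδ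
      obtain ⟨x₁, hx₁, h⟩ := happr η hη
      refine ⟨x₁, hx₁, fun x hx hle => ?_⟩
      have h1 : dist (Real.arctan (u x)) (Real.arctan d) < δ := hcont (by rw [Real.dist_eq]; exact h x hx hle)
      rw [Real.dist_eq] at h1
      rw [Fin.sum_univ_three]
      simpa using h1
  rcases hsgn with hc | hdec | hinc
  · -- (0) a constant edge: `A` is itself a constant circle band
    have hconst : ∀ x ∈ T, u x = u x₂ := fun x hx => const_of_du_eq_zero hTo hTc hud hc x hx x₂ hx₂
    have hcs : SaConst T (u x₂) := hu.congr fun x hx => hconst x hx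
    have hintc : IntegrableOn (fun x => p x * Gn n (u x₂)) T :=
      hint.congr_fun (fun x hx => by
        show p x * Gn n (u x) = p x * Gn n (u x₂)
        rw [hconst x hx]) hTm
    let K : KZ.IntegralRep 2 := circRep hT hcs hp n (fun _ _ => hu0 x₂ hx₂) hintc
    have hKd : K.domain = KZlog.band T (fun _ => 0) (fun _ => u x₂) := rfl
    have eA : cl A = cl K :=
      cl_eq_of_eqOn (by rw [hAd, hKd]; exact band_congr (a := fun _ => 0) fun x hx => (hconst x hx).symm)
        fun z hz => hAi hz
    have hw0 : EqOn Z₂.integrand (fun z => 1 * (p (Fin.init z) * qk n (u (bpt (z (Fin.last 1)))) *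
        du u (bpt (z (Fin.last 1)))) + wfun (fun x => (-1) ^ n * p x) u z) Z₂.domain := fun z hz => by
      rw [hZ₂d] at hz
      rw [hZ₂i, Pi.zero_apply]
      simp only [wfun, hc _ hz.2.1, mul_zero, zero_div, add_zero]
    refine whole (u x₂) K Z₂ (hu0 x₂ hx₂) hcs hKd rfl hZ₂d hw0 (by rw [eA, hZ₂cl, sub_zero]) (fun δ hδ =>
      ⟨x₂, hx₂, fun x hx _ => by rw [hconst x hx, sub_self, abs_zero]; exact hδ⟩) fun hpos => ?_
    exact integrableOn_of_Gn_lower hT n hp hint (x₁ := x₂) (Gn_pos n hpos)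
      (fun x hx _ => by rw [hconst x hx]) (hloc x₂ hx₂)
  · -- (1) decreasing towards the top end (incl. the WILD end `d = 0`): whole kernel
    obtain ⟨d, K, W, hd0, hds, hKd, hKi, hWd, hWi, eA, hdlt, happr⟩ :=
      dec_piece_circ hT hTo hTc ⟨x₂, hx₂⟩ n hp hu hu0 hud hdec A hAd hAi hint
    have hWi' : EqOn W.integrand (fun z => 1 * (p (Fin.init z) * qk n (u (bpt (z (Fin.last 1)))) *
        du u (bpt (z (Fin.last 1)))) + wfun (fun x => (-1) ^ n * p x) u z) W.domain := fun z hz => by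
      rw [hWi]
      have h : (1 + u (bpt (z (Fin.last 1))) ^ 2) ≠ 0 := by positivity
      simp only [wcirc, wfun, gk_eq]
      field_simp
    refine whole d K W hd0 hds hKd hKi hWd hWi' eA happr fun hpos => ?_
    exact integrableOn_of_Gn_lower hT n hp hint (x₁ := x₂) (Gn_pos n hpos)
      (fun x hx _ => Gn_monotone n (hdlt x hx).le) (hloc x₂ hx₂)
  · -- increasing towards the top end: first `p ∈ L¹(T)`
    have hmono : StrictMonoOn (fun s => u (bpt s)) (bpt ⁻¹' T) := strictMonoOn_of_du_pos hTo hTc hud hinc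
    have hle_of_le : ∀ x ∈ T, ∀ y ∈ T, x 0 ≤ y 0 → u x ≤ u y := fun x hx y hy hxy => by
      have := hmono.monotoneOn (mem_preimage_bpt hx) (mem_preimage_bpt hy) hxy
      simpa only [bpt_apply_zero] using this
    have hpos₂ : 0 < u x₂ := by
      obtain ⟨y, hy, hyx⟩ := exists_mem_lt hTo hx₂
      have h := hmono (mem_preimage_bpt hy) (mem_preimage_bpt hx₂) hyx
      simp only [bpt_apply_zero] at h
      exact (hu0 y hy).trans_lt h
    have hpi : IntegrableOn p T :=
      integrableOn_of_Gn_lower hT n hp hint (x₁ := x₂) (Gn_pos n hpos₂)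
        (fun x hx hle => Gn_monotone n (hle_of_le x₂ hx₂ x hx hle)) (hloc x₂ hx₂)
    by_cases hb : BddAbove (u '' T)
    · -- (2) increasing and bounded: whole kernel
      obtain ⟨d, K, W, hd0, hds, hKd, hKi, hWd, hWi, eA, hdlt, happr⟩ :=
        inc_piece_circ hT hTo hTc ⟨x₂, hx₂⟩ n hp hu hu0 hud hinc hb hpi A hAd hAi
      have hWi' : EqOn W.integrand (fun z => 1 * (p (Fin.init z) * qk n (u (bpt (z (Fin.last 1)))) *
          du u (bpt (z (Fin.last 1)))) + wfun (fun x => (-1) ^ n * p x) u z) W.domain := fun z hz => by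
        rw [hWi]
        have h : (1 + u (bpt (z (Fin.last 1))) ^ 2) ≠ 0 := by positivity
        simp only [wcirc, wfun, gk_eq]
        field_simp
      exact whole d K W hd0 hds hKd hKi hWd hWi' eA happr fun _ => hpi
    · -- (3) increasing and unbounded: kernel division
      have hqa : IntegrableOn (fun x => p x * Real.arctan (u x)) T := by
        simpa [one_mul] using integrableOn_mul_arctan hT hu hpi 1
      have hqa' : IntegrableOn (fun x => (-1) ^ n * p x * Real.arctan (u x)) T := integrableOn_mul_arctan hT hu hpi _
      let B₁ : KZ.IntegralRep 2 := polyRep hT hu hp n hu0 hint hqa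
      let B₂ : KZ.IntegralRep 2 := arctanRep hT hu hp' hu0 (hqa'.congr_fun (fun x _ => by ring) hTm)
      have hB₁d : B₁.domain = A.domain := by rw [hAd]; rfl
      have hB₂d : B₂.domain = A.domain := by rw [hAd]; rfl
      have rsplit : KZ.of A - KZ.of B₁ - KZ.of B₂ ∈ KZ.relations :=
        circ_kernel_split n A B₁ B₂ hB₁d hB₂d hAi (fun z _ => rfl) fun z _ => by
          show (-1) ^ n * p (Fin.init z) / (1 + z (Fin.last 1) ^ 2) = _
          ring
      have eA : cl A = cl B₁ + cl B₂ := by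
        rw [sub_sub] at rsplit
        have := mk_sub_eq rsplit
        rwa [map_add] at this
      -- the base rep `R = ⟦T; p Q_n(u)⟧`
      have hRint : IntegrableOn (fun x => p x * Qk n (u x)) T := by
        refine Integrable.mono' (hint.norm.add (hqa.norm))
          ((KZ.aestronglyMeasurable_of_isSemialgebraicFunOn (hp.mul_holds (sa_Qk hT hu n)) hTm).congr ?_) ?_
        · exact Filter.Eventually.of_forall fun x => rfl
        · refine (ae_restrict_iff' hTm).2 (Filter.Eventually.of_forall fun x hx => ?_)
          have hG0 : 0 ≤ Gn n (u x) := Gn_nonneg n (hu0 x hx)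
          have ha0 : 0 ≤ Real.arctan (u x) := Real.arctan_nonneg.2 (hu0 x hx)
          show ‖p x * Qk n (u x)‖ ≤ ‖p x * Gn n (u x)‖ + ‖p x * Real.arctan (u x)‖
          rw [Real.norm_eq_abs, Real.norm_eq_abs, Real.norm_eq_abs, abs_mul, abs_mul, abs_mul, abs_of_nonneg hG0,
            abs_of_nonneg ha0, ← mul_add]
          exact mul_le_mul_of_nonneg_left (abs_Qk_le n (hu0 x hx)) (abs_nonneg _)
      let R : KZ.IntegralRep 1 := ⟨T, fun x => p x * Qk n (u x), hT, hp.mul_holds (sa_Qk hT hu n), hRint⟩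
      have rpoly : KZ.of B₁ - KZ.of R ∈ KZ.relations := poly_unfold hT n hp hu hu0 B₁ rfl (fun z _ => rfl) R rfl fun x _ => rfl
      have eB₁ : cl B₁ = cl R := mk_sub_eq rpoly
      -- the arctan part by `edge_package`
      obtain ⟨dv, cv, V, W, hdv0, hdvs, hVd, hVi, hWd, hWi, eB₂, hlim⟩ :=
        edge_package hT hTo hTc ⟨x₂, hx₂⟩ hp' hu hu0 hud (Or.inr (Or.inr hinc)) hone B₂ rfl (fun z _ => rfl)
          (hqa'.congr_fun (fun x _ => by ring) hTm) fun x₁ hx₁ => (hloc x₁ hx₁).const_mul ((-1) ^ n)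
      -- the null constant band `K` (`d = 0`)
      have hint0 : IntegrableOn (fun x => p x * Gn n 0) T := by
        simp only [Gn_zero_right, mul_zero]; exact integrableOn_zero
      let K : KZ.IntegralRep 2 := circRep hT (saConst_zero hT) hp n (fun _ _ => le_rfl) hint0
      have hKcl : cl K = 0 := cl_eq_zero_of_volume K volume_band_zero
      refine ⟨0, 0, K, dv, cv, V, W, R, le_rfl, saConst_zero hT, Or.inl rfl, rfl, rfl, hdv0, hdvs, hVd, ?_, hWd, ?_,
        rfl, fun x _ => by ring, ?_, fun h => absurd h (by norm_num), ?_, fun h => absurd h (lt_irrefl _), fun _ => rfl⟩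
      · intro k z hz
        rw [hVi k hz]
      · intro z hz
        rw [hWi]; ring
      · rw [eA, eB₁, eB₂, hKcl]; abel
      · intro δ hδ
        obtain ⟨x₁, hx₁, h⟩ := hlim δ hδ
        refine ⟨x₁, hx₁, fun x hx hle => ?_⟩
        simpa using h x hx hle

/-! ### §K7 THE HALF-CELL FOLD at the top end (BLUEPRINT STEPS 2–6 composed): packages per index, ONE Newton–Leibniz on
`Rgn T`, the constant-angle fold for all constant bands, and the base reps summing to zero. -/

end AngleFold
end Summit.KontsevichZagierPeriods.RootDecompRelativeModAbsolute.Rung30571.RegularisedLogLayer.CylLog.Leaf.G13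
end
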